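import Summits.NavierStokesRegularity.NavierStokesRegularity.Theses.QuantisedSymmetry
import Summits.NavierStokesRegularity.NavierStokesRegularity.Theses.DssFarFieldSlaving
import Summits.NavierStokesRegularity.NavierStokesRegularity.Theses.Blowup
import Summits.NavierStokesRegularity.NavierStokesRegularity.Theorems.QuantisedSymmetryPolyhedralTruncationBridge
import Summits.NavierStokesRegularity.NavierStokesRegularity.Theorems.QuantisedSymmetryPolyhedralDssProfileExistsDominatesBlowupProfile
import Summits.NavierStokesRegularity.NavierStokesRegularity.Theorems.QuantisedSymmetryPolyhedralDssProfileExistsStubNoSmallConstant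
import Summits.NavierStokesRegularity.NavierStokesRegularity.Theorems.QuantisedSymmetryPolyhedralDssProfileExistsStubPeriodWindow
import Summits.NavierStokesRegularity.NavierStokesRegularity.Theorems.QuantisedSymmetryLiouvilleKillsProfile
import Summits.NavierStokesRegularity.NavierStokesRegularity.Theorems.DssFarFieldSlavingDssTruncationBridge
import Literature.Analysis.FluidPDE.SelfSimilar
import Literature.Analysis.FluidPDE.SelfSimilarLiouville
import Literature.Analysis.FluidPDE.TsaiSelfSimilarHolds
import Mathlib.MeasureTheory.Measure.Haar.InnerProductSpace
import HarnessLib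

/-!
# Strategist sketch s19-g6 (independent census family `s`, gen 6) for crux
`QuantisedSymmetry.PolyhedralDssProfileExists` (stmt-NavierStokesRegularity-1404)

Kernel-checked companion of `STRATEGY-CENSUS-s19.md`.  Nothing here is a new route item; every
theorem is either pure logic over landed declarations or a refutation of a typed strengthening by a
landed theorem.  Sections:

* §1 the crux `X` decides `¬ NavierStokesRegularity` outright (co-binders landed);
* §2 the weaker-intermediate ladder from the summit down: `X → W₂ → W₁ → ¬S`
  (`W₂ = DssFarFieldSlaving.BlowupTypeIDssProfile`, stmt-0155; `W₁ = Blowup.BlowupExists`, stmt-0152),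
  every arrow a landed theorem — so every lossless replacement of `X` is itself summit-deciding;
* §3 the one honest typed decomposition `X₁ → X₂ → X` (time-Type-I existence, spatial-decay upgrade)
  with its assembly proved and `X → X₁`;
* §4 negation: `¬X` is the polyhedral Type-I DSS Liouville statement; the KNSS Liouville conjecture
  (L) implies the kill switch `PolyhedralTypeILiouville` (Schur: an irreducible `G` fixes no vector),
  hence `¬X`;
* §5 strengthenings refuted by landed theorems (small constant: N2; narrow period window: N1;
  steady `L^q` profile: Tsai 1998).
-/

set_option linter.dupNamespace false
set_option linter.unusedVariables false

namespace Summit.NavierStokesRegularity.NavierStokesRegularity.Cruxes.PolyhedralDssProfileExists.StrategistS19g6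

open MeasureTheory Set Filter
open scoped ENNReal
open Literature.Analysis.FluidPDE
open Summit.NavierStokesRegularity.NavierStokesRegularity.Theses

/-- `ℝ³`. -/
abbrev R3 : Type := EuclideanSpace ℝ (Fin 3)

/-- The crux, by name. -/
abbrev X : Prop := QuantisedSymmetry.PolyhedralDssProfileExists

/-! ## §1 The crux decides the summit (negatively) -/

/-- `X → ¬S`: the route's deciding theorem with both co-binders discharged by landed theorems
(`quantisedSymmetry_polyhedralTruncationBridge_proof`, stmt-11331; `ClayUniqueness_holds`, stmt-0153). -/
theorem crux_decides (hX : X) : ¬ _root_.NavierStokesRegularity :=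
  QuantisedSymmetry.closes hX Theorems.quantisedSymmetry_polyhedralTruncationBridge_proof
    QuantisedSymmetry.ClayUniqueness_holds

/-! ## §2 Weaker intermediates, read from the summit down -/

/-- `W₂`: a Type-I (rotated) `λ`-DSS ancient profile exists, no symmetry (stmt-0155, shared by route
DssFarFieldSlaving).  `X → W₂` is the landed `stub_dominatesBlowupProfile` (the two route-local copies
of the statement are definitionally equal). -/
theorem crux_implies_W2 (hX : X) : DssFarFieldSlaving.BlowupTypeIDssProfile :=
  Theorems.PolyhedralDssProfileExists.PolyhedralCell.stub_dominatesBlowupProfile hX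

/-- `W₂` is literally the negation of Tsai's Type-I DSS Liouville conjecture (Literature copy). -/
theorem W2_iff_not_conjecture :
    DssFarFieldSlaving.BlowupTypeIDssProfile ↔ ¬ TypeIDSSLiouvilleConjecture := Iff.rfl

/-- `W₂ → ¬S`: route DssFarFieldSlaving's deciding theorem with its bridge landed
(`dssTruncationBridge_proof`, stmt-14477).  So the lossless weakening `W₂` of `X` still decides the
summit: it is not "short of the summit". -/
theorem W2_decides (hP : DssFarFieldSlaving.BlowupTypeIDssProfile) : ¬ _root_.NavierStokesRegularity :=
  DssFarFieldSlaving.closes Theorems.dssTruncationBridge_proof hP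

/-- `W₁`: finite-time blow-up of a Leray–Hopf classical solution from a rapidly decaying datum
(`Blowup.BlowupExists`, stmt-0152).  `W₂ → W₁` is the landed truncation bridge. -/
theorem W2_implies_W1 (hP : DssFarFieldSlaving.BlowupTypeIDssProfile) : Blowup.BlowupExists :=
  Theorems.dssTruncationBridge_proof hP

/-- `W₁ → ¬S` (Clay uniqueness landed). `W₁` is `¬S` up to local well-posedness bookkeeping
(item `Blowup.BlowupX5aIffNotNoBlowup`), i.e. it restates the (negated) summit. -/
theorem W1_decides (h : Blowup.BlowupExists) : ¬ _root_.NavierStokesRegularity :=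
  Blowup.closes h Blowup.BlowupClayUniqueness_holds

/-! ## §3 The typed decomposition `X₁ → X₂ → X` -/

/-- `X₁` (existence WITHOUT spatial decay): a nontrivial polyhedrally-equivariant `λ`-DSS ancient mild
solution with only the Type-I TIME bound `‖u(t,x)‖ ≤ M/√(−t)`. A consequence of `X`
(`crux_implies_X1`); refuted by (L) exactly like `X` (time shift makes it bounded); open. -/
def X1 : Prop :=
  ∃ G : Subgroup (R3 ≃ₗᵢ[ℝ] R3), Finite G ∧
    (∀ g ∈ G, LinearMap.det (g.toLinearEquiv : R3 →ₗ[ℝ] R3) = 1) ∧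
    (∀ V : Submodule ℝ R3, (∀ g ∈ G, ∀ v ∈ V, g v ∈ V) → V = ⊥ ∨ V = ⊤) ∧
    ∃ c : ℝ, 1 < c ∧ ∃ u : ℝ → R3 → R3,
      IsAncientMildSolution 1 u ∧ (∀ t < 0, AEStronglyMeasurable (u t) volume) ∧
      IsDiscretelySelfSimilar c u ∧ (∃ M : ℝ, HasTypeITimeDecay M u) ∧
      (∀ g ∈ G, ∀ t x, u t (g x) = g (u t x)) ∧ ¬ (∀ t < 0, u t =ᵐ[volume] 0)

/-- `X₂` (spatial-decay upgrade, a Liouville-flavoured regularity statement): every polyhedrally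
equivariant `λ`-DSS ancient mild solution with the Type-I time bound has the space–time Type-I decay
`‖u(t,x)‖ ≤ C₀/(‖x‖+√(−t))`.  Universal, so it cannot give `X` on its own; open (no a-priori spatial
decay is known for bounded ancient mild solutions, KNSS 2009 §1). -/
def X2 : Prop :=
  ∀ G : Subgroup (R3 ≃ₗᵢ[ℝ] R3), Finite G →
    (∀ g ∈ G, LinearMap.det (g.toLinearEquiv : R3 →ₗ[ℝ] R3) = 1) →
    (∀ V : Submodule ℝ R3, (∀ g ∈ G, ∀ v ∈ V, g v ∈ V) → V = ⊥ ∨ V = ⊤) →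
    ∀ c : ℝ, 1 < c → ∀ u : ℝ → R3 → R3,
      IsAncientMildSolution 1 u → (∀ t < 0, AEStronglyMeasurable (u t) volume) →
      IsDiscretelySelfSimilar c u → (∃ M : ℝ, HasTypeITimeDecay M u) →
      (∀ g ∈ G, ∀ t x, u t (g x) = g (u t x)) → ∃ C₀ : ℝ, HasTypeIDecay C₀ u

/-- ASSEMBLY of the split, proved: `X₁ → X₂ → X` (modus ponens; `trivial_seam`). -/
theorem crux_of_split (h₁ : X1) (h₂ : X2) : X := by
  obtain ⟨G, hfin, hdet, hirr, c, hc, u, hanc, hmeas, hdss, hM, heqv, hnt⟩ := h₁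
  exact ⟨G, hfin, hdet, hirr, c, hc, u, hanc, hmeas, hdss,
    h₂ G hfin hdet hirr c hc u hanc hmeas hdss hM heqv, heqv, hnt⟩

/-- The Type-I constant of a witness is nonnegative (evaluate the bound anywhere). -/
theorem typeI_const_nonneg {C₀ : ℝ} {u : ℝ → R3 → R3} (h : HasTypeIDecay C₀ u) : 0 ≤ C₀ := by
  have h1 := h (-1) (by norm_num) 0
  have hpos : (0 : ℝ) < ‖(0 : R3)‖ + Real.sqrt (-(-1 : ℝ)) := by norm_num
  by_contra hneg
  have : C₀ / (‖(0 : R3)‖ + Real.sqrt (-(-1 : ℝ))) < 0 := div_neg_of_neg_of_pos (not_le.mp hneg) hpos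
  exact absurd ((norm_nonneg _).trans h1) (not_le.mpr this)

/-- `X → X₁`: the piece `X₁` is a genuine WEAKENING of the crux. -/
theorem crux_implies_X1 (hX : X) : X1 := by
  obtain ⟨G, hfin, hdet, hirr, c, hc, u, hanc, hmeas, hdss, ⟨C₀, hdec⟩, heqv, hnt⟩ := hX
  exact ⟨G, hfin, hdet, hirr, c, hc, u, hanc, hmeas, hdss,
    ⟨C₀, hdec.hasTypeITimeDecay (typeI_const_nonneg hdec)⟩, heqv, hnt⟩

/-! ## §4 Negation: `¬X` is a Liouville statement; (L) implies the kill switch -/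

/-- The polyhedral Type-I `λ`-DSS Liouville statement (= the DSS case of the kill switch
`QuantisedSymmetry.PolyhedralTypeILiouville`, stmt-1405). -/
def PolyhedralDssLiouville : Prop :=
  ∀ G : Subgroup (R3 ≃ₗᵢ[ℝ] R3), Finite G →
    (∀ g ∈ G, LinearMap.det (g.toLinearEquiv : R3 →ₗ[ℝ] R3) = 1) →
    (∀ V : Submodule ℝ R3, (∀ g ∈ G, ∀ v ∈ V, g v ∈ V) → V = ⊥ ∨ V = ⊤) →
    ∀ c : ℝ, 1 < c → ∀ u : ℝ → R3 → R3,
      IsAncientMildSolution 1 u → (∀ t < 0, AEStronglyMeasurable (u t) volume) →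
      IsDiscretelySelfSimilar c u → (∃ C₀ : ℝ, HasTypeIDecay C₀ u) →
      (∀ g ∈ G, ∀ t x, u t (g x) = g (u t x)) → ∀ t < 0, u t =ᵐ[volume] 0

/-- `¬X ↔ PolyhedralDssLiouville` (pure logic). -/
theorem not_crux_iff : ¬ X ↔ PolyhedralDssLiouville := by
  constructor
  · intro h G hfin hdet hirr c hc u hanc hmeas hdss hdec heqv
    by_contra hnt
    exact h ⟨G, hfin, hdet, hirr, c, hc, u, hanc, hmeas, hdss, hdec, heqv, hnt⟩
  · rintro h ⟨G, hfin, hdet, hirr, c, hc, u, hanc, hmeas, hdss, hdec, heqv, hnt⟩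
    exact hnt (h G hfin hdet hirr c hc u hanc hmeas hdss hdec heqv)

/-- Schur-type lemma: a finite-dimensional irreducibility clause as in the crux forces every
`G`-fixed vector of `ℝ³` to vanish (its span is an invariant line, neither `⊥` nor `⊤`). -/
theorem fixed_vector_eq_zero {G : Subgroup (R3 ≃ₗᵢ[ℝ] R3)}
    (hirr : ∀ V : Submodule ℝ R3, (∀ g ∈ G, ∀ v ∈ V, g v ∈ V) → V = ⊥ ∨ V = ⊤)
    {b : R3} (hb : ∀ g ∈ G, g b = b) : b = 0 := by
  have hinv : ∀ g ∈ G, ∀ v ∈ Submodule.span ℝ ({b} : Set R3),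
      g v ∈ Submodule.span ℝ ({b} : Set R3) := by
    intro g hg v hv
    obtain ⟨r, rfl⟩ := Submodule.mem_span_singleton.1 hv
    refine Submodule.mem_span_singleton.2 ⟨r, ?_⟩
    rw [LinearIsometryEquiv.map_smul, hb g hg]
  rcases hirr _ hinv with h | h
  · have hmem : b ∈ Submodule.span ℝ ({b} : Set R3) := Submodule.mem_span_singleton_self b
    rw [h] at hmem
    exact (Submodule.mem_bot ℝ).1 hmem
  · by_contra hb0
    have h1 : Module.finrank ℝ (Submodule.span ℝ ({b} : Set R3)) = 1 := finrank_span_singleton hb0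
    rw [h, finrank_top, finrank_euclideanSpace_fin] at h1
    omega

/-- If a slice is a.e. equal to a constant `b` and is (everywhere) equivariant under a linear
isometry `g`, then `g b = b` (linear isometries preserve Lebesgue measure, so the two full-measure
sets `{f = b}` and `g⁻¹{f = b}` meet). -/
theorem isometry_fixes_ae_const {f : R3 → R3} {b : R3} (hf : f =ᵐ[volume] fun _ => b)
    (g : R3 ≃ₗᵢ[ℝ] R3) (heqv : ∀ x, f (g x) = g (f x)) : g b = b := by
  have h1 : ∀ᵐ x ∂(volume : Measure R3), f x = b := hf
  have h2 : ∀ᵐ x ∂(volume : Measure R3), f (g x) = b :=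
    (g.measurePreserving).quasiMeasurePreserving.ae_eq hf
  obtain ⟨x, hx1, hx2⟩ := (h1.and h2).exists
  rw [heqv x, hx1] at hx2
  exact hx2

/-- **(L) ⇒ kill switch.** The KNSS Liouville conjecture for bounded ancient mild solutions
(`LiouvilleConjectureNS`, open) implies `QuantisedSymmetry.PolyhedralTypeILiouville` (stmt-1405):
(L) makes every slice a.e. constant, equivariance makes the constant `G`-fixed, irreducibility
makes it zero.  (The Type-I decay hypothesis of the kill switch is not even used.) -/
theorem polyhedralTypeILiouville_of_liouvilleNS (hL : LiouvilleConjectureNS) :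
    QuantisedSymmetry.PolyhedralTypeILiouville := by
  intro G _hfin _hdet hirr u hu hmeas _hdec heqv t ht
  obtain ⟨b, hb⟩ := hL u hu hmeas t ht
  have hfix : ∀ g ∈ G, g b = b := fun g hg =>
    isometry_fixes_ae_const hb g (fun x => heqv g hg t x)
  have hb0 : b = 0 := fixed_vector_eq_zero hirr hfix
  subst hb0
  exact hb

/-- **(L) ⇒ ¬X**, through the landed glue `LiouvilleKillsProfile` (stmt-1408,
`quantisedSymmetry_liouvilleKillsProfile_proof`: time shift + DSS rescaling). -/
theorem liouvilleNS_refutes_crux (hL : LiouvilleConjectureNS) : ¬ X :=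
  Theorems.quantisedSymmetry_liouvilleKillsProfile_proof (polyhedralTypeILiouville_of_liouvilleNS hL)

/-- The kill switch restricted to DSS fields is exactly `¬X`'s content: `PolyhedralTypeILiouville →
PolyhedralDssLiouville` (via the landed glue and `not_crux_iff`). -/
theorem polyhedralDssLiouville_of_killSwitch (h : QuantisedSymmetry.PolyhedralTypeILiouville) :
    PolyhedralDssLiouville :=
  not_crux_iff.1 (Theorems.quantisedSymmetry_liouvilleKillsProfile_proof h)

/-! ### (L) kills the whole negative DSS funnel: `(L) → TypeIDSSLiouvilleConjecture = ¬W₂` -/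

/-- An a.e.-constant slice obeying a Type-I spatial bound `‖f x‖ ≤ C/(‖x‖ + a)`, `a > 0`, is a.e.
zero: the constant is bounded by `|C|/(R + a)` for every radius `R` (the exterior of a ball has
positive measure, so it meets the full-measure set `{f = b}`). -/
theorem ae_const_eq_zero_of_decay {f : R3 → R3} {b : R3} (hf : f =ᵐ[volume] fun _ => b)
    {C a : ℝ} (ha : 0 < a) (hdec : ∀ x, ‖f x‖ ≤ C / (‖x‖ + a)) : b = 0 := by
  by_contra hb
  have hbpos : 0 < ‖b‖ := norm_pos_iff.2 hb
  set R : ℝ := |C| / ‖b‖ with hR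
  have hRnn : 0 ≤ R := div_nonneg (abs_nonneg _) hbpos.le
  have hopen : IsOpen {x : R3 | R < ‖x‖} := isOpen_lt continuous_const continuous_norm
  obtain ⟨x₀, hx₀⟩ : ∃ x : R3, R < ‖x‖ := NormedSpace.exists_lt_norm ℝ R3 R
  have hS : (volume : Measure R3) {x : R3 | R < ‖x‖} ≠ 0 := (hopen.measure_pos volume ⟨x₀, hx₀⟩).ne'
  haveI : NeZero ((volume : Measure R3) {x : R3 | R < ‖x‖}) := ⟨hS⟩
  have h1 : ∀ᵐ x ∂((volume : Measure R3).restrict {x : R3 | R < ‖x‖}), f x = b := ae_restrict_of_ae hf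
  have h2 : ∀ᵐ x ∂((volume : Measure R3).restrict {x : R3 | R < ‖x‖}), x ∈ {x : R3 | R < ‖x‖} :=
    ae_restrict_mem hopen.measurableSet
  obtain ⟨x, hx1, hx2⟩ := (h1.and h2).exists
  have hx2' : R < ‖x‖ := hx2
  have hle : ‖b‖ ≤ |C| / (R + a) := by
    calc ‖b‖ = ‖f x‖ := by rw [hx1]
      _ ≤ C / (‖x‖ + a) := hdec x
      _ ≤ |C| / (‖x‖ + a) := div_le_div_of_nonneg_right (le_abs_self C) (by positivity)
      _ ≤ |C| / (R + a) := div_le_div_of_nonneg_left (abs_nonneg C) (by positivity) (by linarith)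
  have hlt : |C| / (R + a) < ‖b‖ := by
    rw [div_lt_iff₀ (by positivity)]
    have hbR : ‖b‖ * R = |C| := by rw [hR]; field_simp
    nlinarith [mul_pos hbpos ha]
  exact absurd hle (not_le.mpr hlt)

/-- **(L) ⇒ every ancient mild solution with measurable slices and Type-I space–time decay vanishes**
(KNSS 2009 §1 / Albritton–Barker 2019 §1 "(L) excludes Type I", on the crux's own variables): shift
time by `t/2` to land in the bounded class, apply (L) at the slice, kill the constant by the decay. -/
theorem slices_zero_of_liouvilleNS (hL : LiouvilleConjectureNS) {u : ℝ → R3 → R3}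
    (hanc : IsAncientMildSolution 1 u) (hmeas : ∀ t < 0, AEStronglyMeasurable (u t) volume)
    {C₀ : ℝ} (hdec : HasTypeIDecay C₀ u) : ∀ t < 0, u t =ᵐ[volume] 0 := by
  intro t ht
  have hδ : t / 2 < 0 := by linarith
  have hC : 0 ≤ C₀ := typeI_const_nonneg hdec
  set v : ℝ → R3 → R3 := fun s => u (s + t / 2) with hv
  have hvanc : IsAncientMildSolution 1 v := hanc.time_translate hδ.le
  have hvbdd : IsBoundedOn (Iio 0) v := by
    refine ⟨C₀ / Real.sqrt (-(t / 2)), fun s hs x => ?_⟩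
    have hs0 : s < 0 := hs
    have hs' : s + t / 2 < 0 := by linarith
    refine (hdec (s + t / 2) hs' x).trans ?_
    apply div_le_div_of_nonneg_left hC (Real.sqrt_pos.2 (by linarith))
    have hsq : Real.sqrt (-(t / 2)) ≤ Real.sqrt (-(s + t / 2)) := Real.sqrt_le_sqrt (by linarith)
    linarith [norm_nonneg x]
  have hvmeas : ∀ s < 0, AEStronglyMeasurable (v s) volume := fun s hs => hmeas _ (by linarith)
  obtain ⟨b, hb⟩ := hL v ⟨hvanc, hvbdd⟩ hvmeas (t / 2) hδ
  have hvt : v (t / 2) = u t := by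
    show u (t / 2 + t / 2) = u t
    congr 1; ring
  rw [hvt] at hb
  have hb0 : b = 0 :=
    ae_const_eq_zero_of_decay hb (Real.sqrt_pos.2 (by linarith : (0 : ℝ) < -t)) (fun x => hdec t ht x)
  subst hb0
  exact hb

/-- **(L) ⇒ Tsai's Type-I (rotated) DSS Liouville conjecture** (neither DSS nor the rotation is
used: Type-I decay alone suffices under (L)). -/
theorem typeIDSSLiouvilleConjecture_of_liouvilleNS (hL : LiouvilleConjectureNS) :
    TypeIDSSLiouvilleConjecture := fun c =>
  ⟨fun _ u hanc hmeas _ hdec => by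
      obtain ⟨C₀, hC₀⟩ := hdec
      exact slices_zero_of_liouvilleNS hL hanc hmeas hC₀,
   fun R _ u hanc hmeas _ hdec => by
      obtain ⟨C₀, hC₀⟩ := hdec
      exact slices_zero_of_liouvilleNS hL hanc hmeas hC₀⟩

/-- **(L) ⇒ ¬W₂**: the one conjecture (L) refutes the shared Type-I DSS profile crux (stmt-0155)
and with it every route on the negative DSS funnel (`X`, `X₁`, `W₂`). -/
theorem liouvilleNS_refutes_W2 (hL : LiouvilleConjectureNS) : ¬ DssFarFieldSlaving.BlowupTypeIDssProfile :=
  fun h => h (typeIDSSLiouvilleConjecture_of_liouvilleNS hL)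

/-! ## §5 Strengthenings of `X` refuted by landed theorems -/

/-- `S⁺_small`: a witness of `X`'s profile clause with ARBITRARILY SMALL Type-I constant. -/
def SmallConstantProfile : Prop :=
  ∀ ε : ℝ, 0 < ε → ∃ (u : ℝ → R3 → R3) (C₀ : ℝ), C₀ ≤ ε ∧
    IsAncientMildSolution 1 u ∧ (∀ t < 0, AEStronglyMeasurable (u t) volume) ∧
    HasTypeIDecay C₀ u ∧ ¬ (∀ t < 0, u t =ᵐ[volume] 0)

/-- Refuted by N2 `stub_noSmallConstant` (Chae–Wolf 2017 Rem. 1.4 ε-regularity, landed). -/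
theorem not_smallConstantProfile : ¬ SmallConstantProfile := by
  intro h
  obtain ⟨ε, hε, hN2⟩ := Theorems.PolyhedralDssProfileExists.PolyhedralCell.stub_noSmallConstant
  obtain ⟨u, C₀, hC, hanc, hmeas, hdec, hnt⟩ := h ε hε
  exact hnt (hN2 u C₀ hanc hmeas hdec hC)

/-- `S⁺_window`: for a FIXED Type-I constant, witnesses with scaling factor `λ` arbitrarily close
to `1`. -/
def NarrowWindowProfile : Prop :=
  ∃ C₀ : ℝ, 0 < C₀ ∧ ∀ c₁ : ℝ, 1 < c₁ → ∃ (c : ℝ) (u : ℝ → R3 → R3), 1 < c ∧ c < c₁ ∧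
    IsAncientMildSolution 1 u ∧ (∀ t < 0, AEStronglyMeasurable (u t) volume) ∧
    IsDiscretelySelfSimilar c u ∧ HasTypeIDecay C₀ u ∧ ¬ (∀ t < 0, u t =ᵐ[volume] 0)

/-- Refuted by N1 `stub_periodWindow` (Chae–Wolf 2017 Thm 1.3, landed). -/
theorem not_narrowWindowProfile : ¬ NarrowWindowProfile := by
  rintro ⟨C₀, hC₀, h⟩
  obtain ⟨c₁, hc₁, hN1⟩ := Theorems.PolyhedralDssProfileExists.PolyhedralCell.stub_periodWindow C₀ hC₀
  obtain ⟨c, u, hc, hcc, hanc, hmeas, hdss, hdec, hnt⟩ := h c₁ hc₁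
  exact hnt (hN1 c u hc hcc hanc hmeas hdss hdec)

/-- `S⁺_steady`: a nonzero STEADY Leray profile (self-similar for every `λ`) in some `L^q`,
`3 < q < ∞` (the Type-I decay `C₀/(1+|y|)` puts a profile in every such `L^q`). -/
def SteadyProfileLq : Prop :=
  ∃ a : ℝ, 0 < a ∧ ∃ (U : R3 → R3) (P : R3 → ℝ), IsLerayProfile 1 a U P ∧
    (∃ q : ℝ≥0∞, 3 < q ∧ q < ⊤ ∧ MemLp U q) ∧ U ≠ 0

/-- Refuted by Tsai 1998 Thm 1 (`tsai_selfsimilar_holds`, landed; barrier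
`LeraySelfSimilarBlowupExclusion`). -/
theorem not_steadyProfileLq : ¬ SteadyProfileLq := by
  rintro ⟨a, ha, U, P, hprof, ⟨q, hq, hq', hU⟩, hne⟩
  exact hne (tsai_selfsimilar_holds one_pos ha hprof hq hq' hU)

end Summit.NavierStokesRegularity.NavierStokesRegularity.Cruxes.PolyhedralDssProfileExists.StrategistS19g6
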